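import Literature.Probability.LatticeModels.ConformalCovariance
import Literature.Analysis.FluidPDE.HarmonicOfSmallStencil
import Literature.Analysis.PDE.LoewnerNirenbergKelvin
import Mathlib.Analysis.InnerProductSpace.Harmonic.Basic
import HarnessLib

/-!
# Crux `CanonicalDimensionIsWick` (stmt-CriticalPhenomena-15520), line `registered` (birth, reshaped
# gen 2): STUB C `stub_sphereTransport` — small-sphere transport of planar harmonicity

For a Möbius covariant family `S` on `ℝ³` with scaling dimension `Δ = ½`, planar harmonicity of the
slot-symmetrised four-point slices `T_Y(z) = S₄(z, Y) + S₄(Y, z)` below axis mirrors (hypothesis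
(P): `T_Y` is harmonic on `{x_τ < 0}` whenever the injective triple `Y` lies in `{x_τ > 0}`) and the
Kelvin lemma (hypothesis (K): `y ↦ ‖y - c‖⁻¹ v(ι_{c,1} y)` is harmonic at `z ≠ c` when `v` is
harmonic at `ι_{c,1} z`) give harmonicity of `T_Y` on all of `(range Y)ᶜ`.

## Proof (elementary Möbius geometry)

Fix `z₀ ∉ range Y`, the axis `τ = 0` with unit vector `e = e₀`, and `r > 0` with
`3r < ‖Y j - z₀‖` for all `j`. Put `c = z₀ + r e`, `w = e / (2r)` and
`ψ u = ι_{0,1}(u - c) + w = ι_{c,1} u - (c - w)`. Then `(ψ u)₀ = (u - c)₀ / ‖u - c‖² + 1/(2r)`, so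
`(ψ z₀)₀ = -1/r + 1/(2r) < 0`, while `‖Y j - c‖ > 2r` and `|(Y j - c)₀| ≤ ‖Y j - c‖` give
`(ψ Y j)₀ > -1/(2r) + 1/(2r) = 0`; `ψ ∘ Y` is injective (`inversion_injective`). Translation
invariance (twice) and inversion covariance at `Δ = ½` (weights `∏ ‖xᵢ - c‖ ^ (2 · ½) = ∏ ‖xᵢ - c‖`)
give, for `u ≠ c`, `T_{ψY}(ψ u) = ‖u - c‖ · (∏ⱼ ‖Y j - c‖) · T_Y(u)`, i.e.
`T_Y = ‖· - c‖⁻¹ · v ∘ ι_{c,1}` near `z₀` with `v = (∏ⱼ ‖Y j - c‖)⁻¹ · T_{ψY}(· - (c - w))`. By (P),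
`T_{ψY}` is harmonic at `ψ z₀`; transporting by the translation (tree
`harmonicAt_comp_sub_const`) and the constant factor, `v` is harmonic at `ι_{c,1} z₀`; (K) and
`harmonicAt_congr_nhds` on the open set `{u ≠ c} ∋ z₀` conclude.

## References

* P. Di Francesco, P. Mathieu, D. Sénéchal, *Conformal Field Theory* (Springer 1997), §4.1
  (inversion as a generator of the conformal group), §4.3.1 eq. (4.62) (covariance of
  quasi-primary correlators). [`FrancescoMathieuSenechal1997`]
-/

noncomputable section

namespace Summit.CriticalPhenomena.Ising3DConformalLimit.Cruxes.CanonicalDimensionIsWick.Birth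

open Literature.Probability.LatticeModels
open Filter Set Function EuclideanGeometry InnerProductSpace
open scoped Topology BigOperators

/-! ### Covariance bookkeeping -/

/-- **Möbius transport of a configuration at `Δ = ½`.** For a translation invariant family which is
inversion covariant with scaling dimension `½`, the map `ψ = ι_{0,1}(· - c) + w` (translate the pole
`c` to the origin, invert in the unit sphere, translate by `w`) multiplies `S n` by the Kelvin
weight `∏ᵢ ‖xᵢ - c‖` at configurations avoiding the pole `c` (Di Francesco–Mathieu–Sénéchal 1997,
§4.3.1 eq. (4.62) with `|∂x'/∂x|^{-Δ/d} = ‖x - c‖^{2Δ}`). [folklore] -/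
theorem corr_inversion_translate {S : CorrFamily 3} (htr : IsTranslationInvariant S)
    (hinv : IsInversionCovariant (1 / 2 : ℝ) S) {n : ℕ} (c w : EuclideanSpace ℝ (Fin 3))
    (x : Fin n → EuclideanSpace ℝ (Fin 3)) (hx : ∀ i, x i ≠ c) :
    S n (fun i => inversion (0 : EuclideanSpace ℝ (Fin 3)) 1 (x i - c) + w) =
      (∏ i, ‖x i - c‖) * S n x := by
  have h1 : S n (fun i => inversion (0 : EuclideanSpace ℝ (Fin 3)) 1 (x i - c) + w) =
      S n (fun i => inversion (0 : EuclideanSpace ℝ (Fin 3)) 1 (x i - c)) :=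
    htr n w _
  have h2 : S n (fun i => inversion (0 : EuclideanSpace ℝ (Fin 3)) 1 (x i - c)) =
      (∏ i, ‖x i - c‖ ^ (2 * (1 / 2 : ℝ))) * S n (fun i => x i - c) :=
    hinv n _ fun i => sub_ne_zero.2 (hx i)
  have h3 : S n (fun i => x i - c) = S n x := by
    have h := htr n (-c) x
    simpa only [← sub_eq_add_neg] using h
  rw [h1, h2, h3]
  congr 1
  refine Finset.prod_congr rfl fun i _ => ?_
  rw [show (2 : ℝ) * (1 / 2) = 1 by norm_num, Real.rpow_one]

/-- Coordinates of the unit inversion with pole `0`: `(ι_{0,1} y)ᵢ = yᵢ / ‖y‖²`. [folklore] -/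
private theorem inversion_zero_one_apply (y : EuclideanSpace ℝ (Fin 3)) (i : Fin 3) :
    (inversion (0 : EuclideanSpace ℝ (Fin 3)) 1 y) i = y i / ‖y‖ ^ 2 := by
  rw [inversion, vsub_eq_sub, sub_zero, vadd_eq_add, add_zero, dist_zero_right, PiLp.smul_apply,
    smul_eq_mul, div_pow, one_pow, one_div, inv_mul_eq_div]

/-- The unit inversion with pole `c` is the unit inversion with pole `0` conjugated by the
translation, shifted: `ι_{c,1} u - (c - w) = ι_{0,1}(u - c) + w`. [folklore] -/
private theorem inversion_sub_eq (c w u : EuclideanSpace ℝ (Fin 3)) :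
    inversion c 1 u - (c - w) = inversion (0 : EuclideanSpace ℝ (Fin 3)) 1 (u - c) + w := by
  rw [Literature.Analysis.PDE.LoewnerNirenberg.inversion_eq_inversion_zero_sub_add c 1 u]
  abel

/-! ### The registered stub -/

/-- **STUB C (small-sphere transport).** For a Möbius covariant `S` with `Δ = ½`, planar
harmonicity of the symmetrised slices `z ↦ S 4 (Fin.cons z Y) + S 4 (Fin.snoc Y z)` below axis
mirrors (for all axes `τ` and all injective triples `Y` in `{x_τ > 0}`) and the Kelvin lemma give
harmonicity of the symmetrised slice on all of `(range Y)ᶜ`: a small sphere round `z₀ ∉ range Y`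
through the pole `c = z₀ + r e₀` of a unit inversion becomes the plane `{x₀ = -1/(2r)}` after the
shift `w = e₀/(2r)`, its interior the far side `{x₀ < 0}` and the poles `Y` the near side
`{x₀ > 0}`; inversion covariance at `Δ = ½` produces exactly the Kelvin weight `‖u - c‖⁻¹`
(Di Francesco–Mathieu–Sénéchal 1997, §4.1, §4.3.1 eq. (4.62)). [folklore] -/
theorem stub_sphereTransport :
    ∀ S : CorrFamily 3, IsMoebiusCovariant (1 / 2 : ℝ) S →
      (∀ (τ : Fin 3) (Y : Fin 3 → EuclideanSpace ℝ (Fin 3)), Function.Injective Y →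
        (∀ j, 0 < Y j τ) →
        InnerProductSpace.HarmonicOnNhd
          (fun z => S 4 (Fin.cons z Y) + S 4 (Fin.snoc Y z)) {z | z τ < 0}) →
      (∀ (v : EuclideanSpace ℝ (Fin 3) → ℝ) (c z : EuclideanSpace ℝ (Fin 3)), z ≠ c →
        InnerProductSpace.HarmonicAt v (EuclideanGeometry.inversion c 1 z) →
        InnerProductSpace.HarmonicAt
          (fun y => ‖y - c‖⁻¹ * v (EuclideanGeometry.inversion c 1 y)) z) →
      ∀ Y : Fin 3 → EuclideanSpace ℝ (Fin 3), Function.Injective Y →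
        InnerProductSpace.HarmonicOnNhd
          (fun z => S 4 (Fin.cons z Y) + S 4 (Fin.snoc Y z)) (Set.range Y)ᶜ := by
  intro S hM hP hK Y hY z₀ hz₀
  have htr : IsTranslationInvariant S := hM.isEuclideanInvariant.1
  have hinv : IsInversionCovariant (1 / 2 : ℝ) S := hM.isInversionCovariant
  -- the poles are at positive distance from `z₀`; choose the radius `r`
  have hYz : ∀ j, Y j ≠ z₀ := fun j h => hz₀ ⟨j, h⟩
  obtain ⟨j₀, hj₀⟩ := Finite.exists_min fun j => ‖Y j - z₀‖
  obtain ⟨r, hr⟩ : ∃ r : ℝ, r = ‖Y j₀ - z₀‖ / 4 := ⟨_, rfl⟩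
  have hm0 : 0 < ‖Y j₀ - z₀‖ := norm_pos_iff.2 (sub_ne_zero.2 (hYz j₀))
  have hr0 : 0 < r := by rw [hr]; positivity
  have hYfar : ∀ j, 3 * r < ‖Y j - z₀‖ := fun j => by
    have h := hj₀ j
    rw [hr]
    linarith
  -- the axis `e = e₀`, the pole `c`, the shift `w`
  obtain ⟨e, hne, he0⟩ : ∃ e : EuclideanSpace ℝ (Fin 3), ‖e‖ = 1 ∧ e 0 = 1 :=
    ⟨EuclideanSpace.single 0 1, by simp, by simp⟩
  obtain ⟨c, hc⟩ : ∃ c : EuclideanSpace ℝ (Fin 3), c = z₀ + r • e := ⟨_, rfl⟩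
  obtain ⟨w, hw⟩ : ∃ w : EuclideanSpace ℝ (Fin 3), w = (1 / (2 * r)) • e := ⟨_, rfl⟩
  have hw0 : w 0 = 1 / (2 * r) := by rw [hw, PiLp.smul_apply, he0, smul_eq_mul, mul_one]
  have hzc : z₀ - c = -(r • e) := by rw [hc]; abel
  have hzc_norm : ‖z₀ - c‖ = r := by
    rw [hzc, norm_neg, norm_smul, hne, mul_one, Real.norm_eq_abs, abs_of_pos hr0]
  have hz₀c : z₀ ≠ c := by
    intro h
    rw [h, sub_self, norm_zero] at hzc_norm
    exact hr0.ne hzc_norm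
  have hYc : ∀ j, 2 * r < ‖Y j - c‖ := fun j => by
    have h1 : ‖Y j - z₀‖ ≤ ‖Y j - c‖ + ‖c - z₀‖ := norm_sub_le_norm_sub_add_norm_sub _ _ _
    rw [norm_sub_rev c z₀, hzc_norm] at h1
    linarith [hYfar j]
  have hYc' : ∀ j, Y j ≠ c := fun j h => by
    have h' := hYc j
    rw [h, sub_self, norm_zero] at h'
    linarith
  -- the Möbius map `ψ` and the transported poles `Z`
  obtain ⟨ψ, hψ⟩ : ∃ ψ : EuclideanSpace ℝ (Fin 3) → EuclideanSpace ℝ (Fin 3),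
      ∀ u, ψ u = inversion (0 : EuclideanSpace ℝ (Fin 3)) 1 (u - c) + w := ⟨_, fun _ => rfl⟩
  have hψ0 : ∀ u, ψ u 0 = (u - c) 0 / ‖u - c‖ ^ 2 + 1 / (2 * r) := fun u => by
    rw [hψ, PiLp.add_apply, inversion_zero_one_apply, hw0]
  have hψz₀ : ψ z₀ 0 < 0 := by
    rw [hψ0, hzc_norm, hzc, PiLp.neg_apply, PiLp.smul_apply, he0, smul_eq_mul, mul_one]
    have hr0' : r ≠ 0 := hr0.ne'
    have h : -r / r ^ 2 + 1 / (2 * r) = -(1 / (2 * r)) := by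
      field_simp
      ring
    rw [h, neg_lt_zero]
    positivity
  have hψY : ∀ j, 0 < ψ (Y j) 0 := fun j => by
    rw [hψ0]
    have hd : 2 * r < ‖Y j - c‖ := hYc j
    have hd0 : 0 < ‖Y j - c‖ := by linarith
    have ha : -‖Y j - c‖ ≤ (Y j - c) 0 := by
      have h := PiLp.norm_apply_le (Y j - c) 0
      rw [Real.norm_eq_abs] at h
      exact neg_le_of_abs_le h
    have h1 : -(1 / ‖Y j - c‖) ≤ (Y j - c) 0 / ‖Y j - c‖ ^ 2 :=
      calc -(1 / ‖Y j - c‖) = -‖Y j - c‖ / ‖Y j - c‖ ^ 2 := by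
            rw [neg_div, pow_two, ← div_div, div_self hd0.ne']
        _ ≤ (Y j - c) 0 / ‖Y j - c‖ ^ 2 := div_le_div_of_nonneg_right ha (by positivity)
    have h2 : 1 / ‖Y j - c‖ < 1 / (2 * r) := one_div_lt_one_div_of_lt (by positivity) hd
    linarith
  obtain ⟨Z, hZ⟩ : ∃ Z : Fin 3 → EuclideanSpace ℝ (Fin 3), ∀ j, Z j = ψ (Y j) := ⟨_, fun _ => rfl⟩
  have hZpos : ∀ j, 0 < Z j 0 := fun j => by rw [hZ]; exact hψY j
  have hZinj : Function.Injective Z := by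
    intro i j hij
    rw [hZ, hZ, hψ, hψ] at hij
    exact hY (sub_left_injective
      (inversion_injective (0 : EuclideanSpace ℝ (Fin 3)) one_ne_zero (add_right_cancel hij)))
  -- the Kelvin weight of the poles
  obtain ⟨P, hPeq⟩ : ∃ P : ℝ, P = ∏ j, ‖Y j - c‖ := ⟨_, rfl⟩
  have hP0 : 0 < P := by
    rw [hPeq]
    exact Finset.prod_pos fun j _ => by linarith [hYc j]
  -- covariance of the two orderings
  have hcons : ∀ u, (Fin.cons (ψ u) Z : Fin 4 → EuclideanSpace ℝ (Fin 3)) =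
      fun i => inversion (0 : EuclideanSpace ℝ (Fin 3)) 1
        ((Fin.cons u Y : Fin 4 → EuclideanSpace ℝ (Fin 3)) i - c) + w := by
    intro u
    funext i
    refine Fin.cases ?_ (fun j => ?_) i
    · simp only [Fin.cons_zero, hψ]
    · simp only [Fin.cons_succ, hZ, hψ]
  have hsnoc : ∀ u, (Fin.snoc Z (ψ u) : Fin 4 → EuclideanSpace ℝ (Fin 3)) =
      fun i => inversion (0 : EuclideanSpace ℝ (Fin 3)) 1
        ((Fin.snoc Y u : Fin 4 → EuclideanSpace ℝ (Fin 3)) i - c) + w := by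
    intro u
    funext i
    refine Fin.lastCases ?_ (fun j => ?_) i
    · simp only [Fin.snoc_last, hψ]
    · simp only [Fin.snoc_castSucc, hZ, hψ]
  have hconsS : ∀ u, u ≠ c → S 4 (Fin.cons (ψ u) Z) = (‖u - c‖ * P) * S 4 (Fin.cons u Y) := by
    intro u hu
    have hx : ∀ i, (Fin.cons u Y : Fin 4 → EuclideanSpace ℝ (Fin 3)) i ≠ c := fun i => by
      refine Fin.cases ?_ (fun j => ?_) i
      · rw [Fin.cons_zero]
        exact hu
      · rw [Fin.cons_succ]
        exact hYc' j
    rw [hcons u, corr_inversion_translate htr hinv c w _ hx, Fin.prod_univ_succ, hPeq]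
    simp only [Fin.cons_zero, Fin.cons_succ]
  have hsnocS : ∀ u, u ≠ c → S 4 (Fin.snoc Z (ψ u)) = (‖u - c‖ * P) * S 4 (Fin.snoc Y u) := by
    intro u hu
    have hx : ∀ i, (Fin.snoc Y u : Fin 4 → EuclideanSpace ℝ (Fin 3)) i ≠ c := fun i => by
      refine Fin.lastCases ?_ (fun j => ?_) i
      · rw [Fin.snoc_last]
        exact hu
      · rw [Fin.snoc_castSucc]
        exact hYc' j
    rw [hsnoc u, corr_inversion_translate htr hinv c w _ hx, Fin.prod_univ_castSucc, hPeq]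
    simp only [Fin.snoc_castSucc, Fin.snoc_last, mul_comm]
  have hTZ : ∀ u, u ≠ c → S 4 (Fin.cons (ψ u) Z) + S 4 (Fin.snoc Z (ψ u)) =
      (‖u - c‖ * P) * (S 4 (Fin.cons u Y) + S 4 (Fin.snoc Y u)) := fun u hu => by
    rw [hconsS u hu, hsnocS u hu, mul_add]
  -- the function `v` of the Kelvin lemma
  obtain ⟨v, hv⟩ : ∃ v : EuclideanSpace ℝ (Fin 3) → ℝ, ∀ x,
      v x = P⁻¹ * (S 4 (Fin.cons (x - (c - w)) Z) + S 4 (Fin.snoc Z (x - (c - w)))) :=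
    ⟨_, fun _ => rfl⟩
  have hinvψ : ∀ u, inversion c 1 u - (c - w) = ψ u := fun u => by rw [hψ, inversion_sub_eq]
  -- (P): `T_Z` is harmonic at `ψ z₀`, hence `v` is harmonic at `ι_{c,1} z₀`
  have hTharm : HarmonicAt (fun z => S 4 (Fin.cons z Z) + S 4 (Fin.snoc Z z)) (ψ z₀) :=
    hP 0 Z hZinj hZpos (ψ z₀) hψz₀
  have h2 : HarmonicAt ((P⁻¹ : ℝ) • fun z => S 4 (Fin.cons z Z) + S 4 (Fin.snoc Z z))
      (inversion c 1 z₀ - (c - w)) := by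
    rw [hinvψ z₀]
    exact hTharm.const_smul
  have h3 := Literature.Analysis.FluidPDE.harmonicAt_comp_sub_const (c - w) h2
  have hvfun : (fun x => ((P⁻¹ : ℝ) • fun z => S 4 (Fin.cons z Z) + S 4 (Fin.snoc Z z))
      (x - (c - w))) = v := by
    funext x
    rw [hv x, Pi.smul_apply, smul_eq_mul]
  rw [hvfun] at h3
  -- (K): the Kelvin transform of `v` is harmonic at `z₀`, and it is `T_Y` near `z₀`
  have hKel := hK v c z₀ hz₀c h3
  refine (harmonicAt_congr_nhds ?_).2 hKel
  filter_upwards [isOpen_ne.mem_nhds hz₀c] with u hu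
  have hne0 : ‖u - c‖ * P ≠ 0 := mul_ne_zero (norm_ne_zero_iff.2 (sub_ne_zero.2 hu)) hP0.ne'
  calc S 4 (Fin.cons u Y) + S 4 (Fin.snoc Y u)
      = (‖u - c‖ * P)⁻¹ * ((‖u - c‖ * P) * (S 4 (Fin.cons u Y) + S 4 (Fin.snoc Y u))) := by
        rw [← mul_assoc, inv_mul_cancel₀ hne0, one_mul]
    _ = ‖u - c‖⁻¹ * v (inversion c 1 u) := by
        rw [hv, hinvψ, hTZ u hu, mul_inv, mul_assoc]

end Summit.CriticalPhenomena.Ising3DConformalLimit.Cruxes.CanonicalDimensionIsWick.Birth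

end
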